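import Summits.QuantumFields.BalabanUV.Beta.MultiscaleDecayBudget
import Summits.QuantumFields.BalabanUV.Beta.MultiscaleConjError
import Summits.QuantumFields.BalabanUV.Beta.MultiscaleCombesThomasBudget
import Summits.QuantumFields.BalabanUV.Beta.CovariantTowerMatrix

/-!
# Beta / MultiscaleDecay — NODE (w2′) OF THE O.2 SKELETON §8.5, FILE 2 OF 2: THE k-UNIFORM DECAY OF THE MULTI-REGION AVERAGED OPERATOR
# ON THE TORUS WITH LOCAL PREFACTORS (MODEL; the DECAY half of O.2 item (v) «k-UNIFORM constants», ENTRY level)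

For pv21's `levelOp = Δ_U + Σ_l a_l·G_lᵀG_l` on the torus `UT N` — ANY isometric bond matrices `Rm` and level transports `T` — whose level-`l`
averaging weights live on a pairwise-disjoint COVERING family of cubes (cell `k`: level `l_k`, side `S_{l_k}`) with print-size weights from
above (`a_lω_l²S_l^d ≤ a_max/S_l²`), and ANY local coercivity of the cell-sum shape `C·Σ_k S_{l_k}⁻²‖f‖²_{cell k} ≤ ⟨f, levelOp f⟩` (supplied
LEVEL-COUNT-FREE by (D) `multiscale_coercive_torus_flat` at `U = 1` and by (H) `multiscale_coercive_torus_cov` under a per-cube (3.35)-shape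
gauge), the inverse decays in the SCALE-ADAPTED distance `d_n` of (K) `MultiscaleDistance` with LOCAL prefactors:
**`|(levelOp)⁻¹((x,i),(y,i′))| ≤ e^{−κ·d_n(x,y)}·n(x)·n(y)/μ₀`,  `μ₀ = C − 2d·c_max²·κ² − a_max·(e^{2dκ} − 1) > 0`** for every `κ ∈ [0, 1]`
making `μ₀` positive — a rate per CELL-SIZE unit and constants depending on `d, c, a, C` only: neither on the sides, nor on the levels or
their number, nor on the volume.  The analytic input is the row owner's site-local Combes–Thomas END
`MultiscaleCombesThomasBudget.norm_cmat_inv_apply_le_local` (an4-g42, p228368) BY NAME, fed with the conjugated-form identity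
`MultiscaleConjError.conjForm_eq`, the second-order budget `conjErr_levelOp_ge_local_cosh` (p230159) and file 1's two local-scale bounds
(unit `b2b-balaban-beta-d4-p2`, GEN 8, MODEL crew; claim «MULTISCALE-DECAY-MODEL» journal l.18614, part (L)).

HONEST FRAMING: discharging `BetaPertH` makes Bałaban's UV stability UNCONDITIONAL — NOT the continuum limit, NOT the Clay problem.
HONEST DEPENDENCY (verbatim): «continuum YM on T⁴ ⇐ BetaPertH ∧ nine spine estimates (0/9 proved); BetaPertH ⇐ (D1) ∧ (D4) ∧ CAP+tail;
G-an2-4 gates asym, D1 and NE2/3/4.»  THIS MODULE DISCHARGES NOTHING of `BetaPertH`, asserts NOTHING printed and cites nothing as a fact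
(ABSOLUTE RULE): [folklore] Combes–Thomas bookkeeping about the pv21∕b05 torus MODEL; weights, coefficients, transports, gauges and the
cell family are DATA.  CURRENCY (d4-p3-g9 XREAD C-d4p3-28 INFO-1, adopted): this is [B9] Thm 3.1 (3.42) ENTRY-1's local-prefactor SHAPE
AT THE ENTRY LEVEL (`n(x)·n(y)·e^{−κd_n(x,y)}`); print's (3.42) is a sup-norm operator bound cube → cube and needs an ℓ² → ℓ^∞ device in
addition — NOT claimed here.  NOT modelled: Dirichlet holes `Ω₀` (successor node (w3)), print's region geometry ([B6] (2.1)–(2.2)),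
Bałaban's own `U_k`, `Ū^l`, the vector operators.  LOCI (shape only): [B9] = `Balaban1985BackgroundPropagators` (3.24) p. 394, (3.35)
p. 396, Thm 3.1 (3.42) p. 397 («constants depending on d and L only»); [B6] = `Balaban1984PropagatorsII` (2.46) p. 231.  No class change
on row D4 (critical-path width 0; D4 DISCHARGE NO DATE); NOT BetaPertH, NOT continuum, NOT Clay, NOT summit progress.

CONTENT (kernel, 0 sorry).  §1 **`hc_levelOp`**: the owner's hypothesis `Σ_p μ_p v_p² ≤ Σ_p e^{κd(p,y)}v_p·(A(e^{−κd(·,y)}v))_p` for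
`A = levelOp`, `d = d_n` on sites, `μ_p = μ₀·n(p)⁻²`.  §2 `posDef_of_coercive`, **`decay_levelOp`** (THE END: `IsUnit A` and the entry bound
for `Ring.inverse A`).  §3 **`decay_levelOp_flat`** ((D): `U = 1`, `C = min(c²/(4d), a_min/2)`), **`decay_levelOp_cov`** ((H): COVARIANT,
per-cube (3.35)-shape gauge, `C = (1 − θ)·min(c²/(4d), a_min/4)`).
-/

namespace Summit.QuantumFields.BalabanUV.Beta.MultiscaleDecay

open Finset Function
open Summit.QuantumFields.BalabanUV.Beta.BoxPoincare (Box)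
open Summit.QuantumFields.BalabanUV.Beta.CovariantBoxPoincare (hol succ)
open Summit.QuantumFields.BalabanUV.Beta.MultiscaleCoerciveTorus
open Summit.QuantumFields.BalabanUV.Beta.MultiscaleCoerciveTorusCov (multiscale_coercive_torus_cov)
open Summit.QuantumFields.BalabanUV.Beta.MultiscaleConjError (siteSq siteSq_nonneg conjErr_levelOp_ge_local_cosh conjForm_eq)
open Summit.QuantumFields.BalabanUV.Beta.MultiscaleDistance
open Summit.QuantumFields.BalabanUV.Beta.MultiscaleDecayBudget
open Summit.QuantumFields.BalabanUV.Beta.MultiscaleCombesThomasBudget (norm_cmat_inv_apply_le_local)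
open Summit.QuantumFields.BalabanUV.Beta.CovariantTowerMatrix (cmat cmat_ringInverse norm_cmat_apply)
open Literature.MathematicalPhysics.QuantumFieldTheory.Balaban1983to89
open Literature.MathematicalPhysics.QuantumFieldTheory.Balaban1983to89.B9Thm37GluePU (bsrc btgt bsrc_apply btgt_apply)
open Literature.MathematicalPhysics.QuantumFieldTheory.Balaban1983to89.B9Thm37GlueTorusCov (tblk torusComb)
open Literature.MathematicalPhysics.QuantumFieldTheory.Balaban1983to89.B9Thm37GlueTorusCovLevels (levelOp)
open Literature.MathematicalPhysics.QuantumFieldTheory.Balaban1983to89.B9Thm37GlueTorusCovCT (expW conjErr)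
open Literature.MathematicalPhysics.QuantumFieldTheory.Balaban1983to89.B9Thm37GlueTorusInv (isUnit_of_posDef)
open B5TorusCover (UT Ctr ctrU)

noncomputable section

variable {d : ℕ} {N : Fin d → ℕ} [∀ i, NeZero (N i)] [NeZero d] {Cp J K : Type} [Fintype Cp] [DecidableEq Cp] [Fintype J] [Fintype K]
  (S : J → ℕ) (hS : ∀ l, 1 ≤ S l) (hdivS : ∀ l i, S l ∣ N i) (lvl : K → J) (zc : (k : K) → Ctr N (S (lvl k)))

/-! ## §1 The owner's local hypothesis for `levelOp` with the profile `μ₀·n(p)⁻²` -/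

section Hyp

/-- **THE SITEWISE CONJUGATED COERCIVITY OF `levelOp` ALONG THE SCALE-ADAPTED WEIGHT (MODEL).**  Torus `UT N`; isometric `Rm`, `T`;
`a ≥ 0`; level weights `ω_l` supported on the level-`l` cells of a disjoint covering family (`hsupp`) and print-size from above
(`a_lω_l²S_l^d ≤ a_max/S_l²`); `|c| ≤ c_max`; a cell-sum coercivity with constant `C`; `0 ≤ κ ≤ 1`.  Then for every target `y` and
every real `v`, with `n` = site scale and `φ = κ·d_n(·, y₁)`:
`Σ_p (C − 2d·c_max²κ² − a_max(e^{2dκ} − 1))·n(p₁)⁻²·v_p² ≤ Σ_p e^{φ(p₁)}v_p·(levelOp(e^{−φ}v))_p` — the hypothesis `hc` of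
`MultiscaleCombesThomasBudget.norm_cmat_inv_apply_le_local`. [cite: Balaban1985BackgroundPropagators, (3.24) p.394 + Thm 3.1 (3.42) p.397] -/
theorem hc_levelOp (hdisj : ∀ k k' v v', cellPt S hS hdivS lvl zc k v = cellPt S hS hdivS lvl zc k' v' → k = k')
    (hcover : ∀ x : UT N, ∃ k, ∃ v : Box d (S (lvl k)), cellPt S hS hdivS lvl zc k v = x)
    (Rm : UT N × Fin d → Cp → Cp → ℝ) (hRm : ∀ b i j, ∑ k, Rm b k i * Rm b k j = if i = j then (1 : ℝ) else 0)
    (T : J → UT N → Cp → Cp → ℝ) (hT : ∀ l x i i', ∑ k, T l x k i * T l x k i' = if i = i' then (1 : ℝ) else 0)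
    (a : J → ℝ) (ha : ∀ j, 0 ≤ a j) (ω : J → UT N → ℝ)
    (hsupp : ∀ l x, ω l (ctrU N (S l) (tblk (hS l) (hdivS l) x)) ≠ 0 → ∃ k v, lvl k = l ∧ cellPt S hS hdivS lvl zc k v = x)
    {amax : ℝ} (hamax : 0 ≤ amax)
    (hscale : ∀ k, a (lvl k) * ω (lvl k) (ctrU N (S (lvl k)) (zc k)) ^ 2 * (S (lvl k) : ℝ) ^ d ≤ amax / (S (lvl k) : ℝ) ^ 2)
    (c : UT N × Fin d → ℝ) {cmax : ℝ} (hc : ∀ b, |c b| ≤ cmax) {C : ℝ}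
    (hcoer : ∀ f : UT N × Cp → ℝ,
      C * ∑ k, ((S (lvl k) : ℝ) ^ 2)⁻¹ * ∑ v : Box d (S (lvl k)), ∑ i, f (cellPt S hS hdivS lvl zc k v, i) ^ 2 ≤
        ∑ p, f p * levelOp bsrc btgt c Rm (fun l x => ctrU N (S l) (tblk (hS l) (hdivS l) x))
          (fun l x => ω l (ctrU N (S l) (tblk (hS l) (hdivS l) x))) T a f p)
    {κ : ℝ} (hκ0 : 0 ≤ κ) (hκ1 : κ ≤ 1) (y : UT N × Cp) (v : UT N × Cp → ℝ) :
    ∑ p, (C - 2 * d * cmax ^ 2 * κ ^ 2 - amax * (Real.exp (2 * d * κ) - 1)) *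
        ((siteScale S hS hdivS lvl zc hcover p.1 : ℝ) ^ 2)⁻¹ * v p ^ 2 ≤
      ∑ p, Real.exp (κ * sdist bsrc btgt (siteScale S hS hdivS lvl zc hcover) p.1 y.1) * v p *
        levelOp bsrc btgt c Rm (fun l x => ctrU N (S l) (tblk (hS l) (hdivS l) x))
          (fun l x => ω l (ctrU N (S l) (tblk (hS l) (hdivS l) x))) T a
          (fun q => Real.exp (-(κ * sdist bsrc btgt (siteScale S hS hdivS lvl zc hcover) q.1 y.1)) * v q) p := by
  classical
  set n := siteScale S hS hdivS lvl zc hcover with hn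
  set A := levelOp bsrc btgt c Rm (fun l x => ctrU N (S l) (tblk (hS l) (hdivS l) x))
    (fun l x => ω l (ctrU N (S l) (tblk (hS l) (hdivS l) x))) T a with hA
  set φ : UT N → ℝ := fun x => κ * sdist bsrc btgt n x y.1 with hφ
  have hn1 : ∀ x, 1 ≤ n x := one_le_siteScale S hS hdivS lvl zc hcover
  -- the conjugated pairing is ⟨v, Av⟩ + ERR
  have hpair : ∑ p, Real.exp (κ * sdist bsrc btgt n p.1 y.1) * v p *
      A (fun q => Real.exp (-(κ * sdist bsrc btgt n q.1 y.1)) * v q) p = ∑ p, v p * A v p + conjErr A φ v := by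
    rw [← conjForm_eq A φ v]
    rfl
  rw [hpair]
  -- the site energies
  set F : UT N → ℝ := siteSq v with hF
  have hF0 : ∀ x, 0 ≤ F x := siteSq_nonneg v
  -- (1) the sitewise coercivity
  have hco : C * ∑ x, ((n x : ℝ) ^ 2)⁻¹ * F x ≤ ∑ p, v p * A v p := by
    rw [hn, ← sum_cells_scale_eq S hS hdivS lvl zc hdisj hcover]
    exact hcoer v
  -- (2) the conjugation error: budgets
  set θ : UT N × Fin d → ℝ := fun b => κ * slen n (bsrc b) (btgt b) with hθ
  have hφb : ∀ b, |φ (btgt b) - φ (bsrc b)| ≤ θ b := by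
    intro b
    rw [hφ, hθ]
    simp only
    rw [← mul_sub, abs_mul, abs_of_nonneg hκ0]
    exact mul_le_mul_of_nonneg_left (abs_sdist_tgt_sub_src_le bsrc btgt n b y.1) hκ0
  set Posc : J → UT N → Prop := fun l β => ∀ x x', ctrU N (S l) (tblk (hS l) (hdivS l) x) = β →
    ctrU N (S l) (tblk (hS l) (hdivS l) x') = β →
      |κ * sdist bsrc btgt n x y.1 - κ * sdist bsrc btgt n x' y.1| ≤ κ * (2 * ((d * (S l - 1) : ℕ) : ℝ) * (S l : ℝ)⁻¹) with hPosc
  set Θ : J → UT N → ℝ := fun l β => if Posc l β then κ * (2 * ((d * (S l - 1) : ℕ) : ℝ) * (S l : ℝ)⁻¹) else ∑ z, φ z with hΘ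
  have hφ0 : ∀ z, 0 ≤ φ z := fun z => mul_nonneg hκ0 (sdist_nonneg bsrc btgt n z y.1)
  have hΘ0 : ∀ l β, 0 ≤ Θ l β := by
    intro l β
    rw [hΘ]
    simp only
    split_ifs
    · positivity
    · exact sum_nonneg fun z _ => hφ0 z
  have hΘP : ∀ l β, Posc l β → Θ l β = κ * (2 * ((d * (S l - 1) : ℕ) : ℝ) * (S l : ℝ)⁻¹) := by
    intro l β hP
    rw [hΘ]
    simp only
    rw [if_pos hP]
  have hosc : ∀ l x x', ctrU N (S l) (tblk (hS l) (hdivS l) x) = ctrU N (S l) (tblk (hS l) (hdivS l) x') →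
      |φ x - φ x'| ≤ Θ l (ctrU N (S l) (tblk (hS l) (hdivS l) x)) := by
    intro l x x' hxx'
    rw [hΘ]
    simp only
    split_ifs with hP
    · exact hP x x' rfl hxx'.symm
    · rw [abs_sub_le_iff]
      constructor
      · linarith [hφ0 x', Finset.single_le_sum (f := φ) (fun z _ => hφ0 z) (mem_univ x)]
      · linarith [hφ0 x, Finset.single_le_sum (f := φ) (fun z _ => hφ0 z) (mem_univ x')]
  have herr := conjErr_levelOp_ge_local_cosh bsrc btgt c Rm (fun l x => ctrU N (S l) (tblk (hS l) (hdivS l) x))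
    (fun l x => ω l (ctrU N (S l) (tblk (hS l) (hdivS l) x))) T a hRm hT ha (fun l β => |ω l β|) (fun l x => le_rfl)
    (fun l β => S l ^ d) (fun l β => card_block_le (hS l) (hdivS l) β) φ θ hφb Θ hΘ0 hosc v
  have hbond := bond_budget_le hn1 c hc hκ0 hκ1 F hF0
  have havg := avg_budget_le S hS hdivS lvl zc hdisj hcover a ω hsupp hamax hscale hκ0 y.1 Θ hΘP F hF0
  -- (3) assemble
  have hlhs : ∑ p : UT N × Cp, (C - 2 * d * cmax ^ 2 * κ ^ 2 - amax * (Real.exp (2 * d * κ) - 1)) *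
      ((n p.1 : ℝ) ^ 2)⁻¹ * v p ^ 2 =
      (C - 2 * d * cmax ^ 2 * κ ^ 2 - amax * (Real.exp (2 * d * κ) - 1)) * ∑ x, ((n x : ℝ) ^ 2)⁻¹ * F x := by
    rw [Fintype.sum_prod_type, Finset.mul_sum]
    refine Finset.sum_congr rfl fun x _ => ?_
    rw [hF]
    unfold siteSq
    rw [Finset.mul_sum, Finset.mul_sum]
    refine Finset.sum_congr rfl fun i _ => ?_
    ring
  rw [hlhs]
  have hsplit : (C - 2 * d * cmax ^ 2 * κ ^ 2 - amax * (Real.exp (2 * d * κ) - 1)) * ∑ x, ((n x : ℝ) ^ 2)⁻¹ * F x =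
      C * ∑ x, ((n x : ℝ) ^ 2)⁻¹ * F x - (2 * d * cmax ^ 2 * κ ^ 2 * ∑ x, ((n x : ℝ) ^ 2)⁻¹ * F x +
        amax * (Real.exp (2 * d * κ) - 1) * ∑ x, ((n x : ℝ) ^ 2)⁻¹ * F x) := by ring
  rw [hsplit]
  have hnB : ∀ l (β : UT N), (((fun (_ : J) (_ : UT N) => S l ^ d) l β : ℕ) : ℝ) = ((S l ^ d : ℕ) : ℝ) := fun _ _ => rfl
  linarith [herr, hbond, havg, hco]

end Hyp

/-! ## §2 THE END: invertibility and the decay of the inverse with local prefactors -/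

section End

omit [NeZero d] [DecidableEq Cp] [Fintype J] in
/-- A cell-sum coercivity with `C > 0` on a disjoint covering family makes the operator strictly positive, hence a unit. [folklore] -/
theorem isUnit_of_coercive (hdisj : ∀ k k' v v', cellPt S hS hdivS lvl zc k v = cellPt S hS hdivS lvl zc k' v' → k = k')
    (hcover : ∀ x : UT N, ∃ k, ∃ v : Box d (S (lvl k)), cellPt S hS hdivS lvl zc k v = x)
    (A : Module.End ℝ (UT N × Cp → ℝ)) {C : ℝ} (hC : 0 < C)
    (hcoer : ∀ f : UT N × Cp → ℝ,
      C * ∑ k, ((S (lvl k) : ℝ) ^ 2)⁻¹ * ∑ v : Box d (S (lvl k)), ∑ i, f (cellPt S hS hdivS lvl zc k v, i) ^ 2 ≤ ∑ p, f p * A f p) :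
    IsUnit A := by
  refine isUnit_of_posDef fun f hf => ?_
  have h : C * ∑ x, ((siteScale S hS hdivS lvl zc hcover x : ℝ) ^ 2)⁻¹ * siteSq f x ≤ ∑ p, f p * A f p := by
    rw [← sum_cells_scale_eq S hS hdivS lvl zc hdisj hcover (siteSq f)]
    exact hcoer f
  refine lt_of_lt_of_le ?_ h
  obtain ⟨⟨x₀, i₀⟩, hx₀⟩ := Function.ne_iff.mp hf
  refine mul_pos hC (lt_of_lt_of_le ?_ (Finset.single_le_sum
    (f := fun x => ((siteScale S hS hdivS lvl zc hcover x : ℝ) ^ 2)⁻¹ * siteSq f x)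
    (fun x _ => mul_nonneg (inv_nonneg.mpr (sq_nonneg _)) (siteSq_nonneg f x)) (mem_univ x₀)))
  have hn : (0 : ℝ) < siteScale S hS hdivS lvl zc hcover x₀ := by
    exact_mod_cast one_le_siteScale S hS hdivS lvl zc hcover x₀
  refine mul_pos (inv_pos.mpr (pow_pos hn 2)) ?_
  exact lt_of_lt_of_le (lt_of_le_of_ne (sq_nonneg (f (x₀, i₀))) (Ne.symm (pow_ne_zero 2 hx₀)))
    (Finset.single_le_sum (f := fun i => f (x₀, i) ^ 2) (fun i _ => sq_nonneg _) (mem_univ i₀))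

/-- **THE k-UNIFORM DECAY OF THE MULTI-REGION AVERAGED OPERATOR WITH LOCAL PREFACTORS (MODEL; node (w2′)).**  Torus `UT N`; isometric
bond matrices `Rm` and level transports `T`; `a ≥ 0`; level weights supported on the level-`l` cells of a pairwise-disjoint COVERING cube
family and print-size from above (`a_lω_l²S_l^d ≤ a_max/S_l²`); `|c| ≤ c_max`; a cell-sum coercivity `C·Σ_k S_{l_k}⁻²‖f‖²_{cell k} ≤
⟨f, levelOp f⟩`; a rate `0 ≤ κ ≤ 1` with `μ₀ := C − 2d·c_max²κ² − a_max(e^{2dκ} − 1) > 0`.  Then `levelOp` is a unit and, with `n(x)` the side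
of the cell of `x` and `d_n` the scale-adapted distance,
**`|(levelOp)⁻¹(δ_{(y,i′)})(x,i)| ≤ e^{−κ·d_n(x,y)}·n(x)·n(y)/μ₀`** — decay at a rate per cell-size unit with LOCAL prefactors, constants
depending on `d, c_max, a_max, C` only (the SHAPE of Thm 3.1 (3.42) entry 1 at the entry level, «constants depending on d and L only»).
[cite: Balaban1985BackgroundPropagators, (3.24) p.394 + Thm 3.1 (3.42) p.397; Balaban1984PropagatorsII, (2.46) p.231] -/
theorem decay_levelOp (hdisj : ∀ k k' v v', cellPt S hS hdivS lvl zc k v = cellPt S hS hdivS lvl zc k' v' → k = k')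
    (hcover : ∀ x : UT N, ∃ k, ∃ v : Box d (S (lvl k)), cellPt S hS hdivS lvl zc k v = x)
    (Rm : UT N × Fin d → Cp → Cp → ℝ) (hRm : ∀ b i j, ∑ k, Rm b k i * Rm b k j = if i = j then (1 : ℝ) else 0)
    (T : J → UT N → Cp → Cp → ℝ) (hT : ∀ l x i i', ∑ k, T l x k i * T l x k i' = if i = i' then (1 : ℝ) else 0)
    (a : J → ℝ) (ha : ∀ j, 0 ≤ a j) (ω : J → UT N → ℝ)
    (hsupp : ∀ l x, ω l (ctrU N (S l) (tblk (hS l) (hdivS l) x)) ≠ 0 → ∃ k v, lvl k = l ∧ cellPt S hS hdivS lvl zc k v = x)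
    {amax : ℝ} (hamax : 0 ≤ amax)
    (hscale : ∀ k, a (lvl k) * ω (lvl k) (ctrU N (S (lvl k)) (zc k)) ^ 2 * (S (lvl k) : ℝ) ^ d ≤ amax / (S (lvl k) : ℝ) ^ 2)
    (c : UT N × Fin d → ℝ) {cmax : ℝ} (hc : ∀ b, |c b| ≤ cmax) {C : ℝ}
    (hcoer : ∀ f : UT N × Cp → ℝ,
      C * ∑ k, ((S (lvl k) : ℝ) ^ 2)⁻¹ * ∑ v : Box d (S (lvl k)), ∑ i, f (cellPt S hS hdivS lvl zc k v, i) ^ 2 ≤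
        ∑ p, f p * levelOp bsrc btgt c Rm (fun l x => ctrU N (S l) (tblk (hS l) (hdivS l) x))
          (fun l x => ω l (ctrU N (S l) (tblk (hS l) (hdivS l) x))) T a f p)
    {κ : ℝ} (hκ0 : 0 ≤ κ) (hκ1 : κ ≤ 1) (hμ : 0 < C - 2 * d * cmax ^ 2 * κ ^ 2 - amax * (Real.exp (2 * d * κ) - 1))
    (p q : UT N × Cp) :
    IsUnit (levelOp bsrc btgt c Rm (fun l x => ctrU N (S l) (tblk (hS l) (hdivS l) x))
        (fun l x => ω l (ctrU N (S l) (tblk (hS l) (hdivS l) x))) T a) ∧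
      |Ring.inverse (levelOp bsrc btgt c Rm (fun l x => ctrU N (S l) (tblk (hS l) (hdivS l) x))
          (fun l x => ω l (ctrU N (S l) (tblk (hS l) (hdivS l) x))) T a) (Pi.single q 1) p| ≤
        Real.exp (-(κ * sdist bsrc btgt (siteScale S hS hdivS lvl zc hcover) p.1 q.1)) *
          ((siteScale S hS hdivS lvl zc hcover p.1 : ℝ) * (siteScale S hS hdivS lvl zc hcover q.1 : ℝ)) /
          (C - 2 * d * cmax ^ 2 * κ ^ 2 - amax * (Real.exp (2 * d * κ) - 1)) := by
  classical
  set n := siteScale S hS hdivS lvl zc hcover with hn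
  set A := levelOp bsrc btgt c Rm (fun l x => ctrU N (S l) (tblk (hS l) (hdivS l) x))
    (fun l x => ω l (ctrU N (S l) (tblk (hS l) (hdivS l) x))) T a with hA
  set μ₀ := C - 2 * d * cmax ^ 2 * κ ^ 2 - amax * (Real.exp (2 * d * κ) - 1) with hμ₀
  have hn0 : ∀ x, (0 : ℝ) < n x := fun x => by exact_mod_cast one_le_siteScale S hS hdivS lvl zc hcover x
  -- C > 0 (the subtracted budgets are ≥ 0), hence A is a unit
  have hC : 0 < C := by
    have h1 : 0 ≤ 2 * (d : ℝ) * cmax ^ 2 * κ ^ 2 := by positivity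
    have h2 : 0 ≤ amax * (Real.exp (2 * d * κ) - 1) := by
      refine mul_nonneg hamax ?_
      have : 0 ≤ 2 * (d : ℝ) * κ := by positivity
      linarith [Real.one_le_exp_iff.mpr this]
    linarith
  have hunit : IsUnit A := isUnit_of_coercive S hS hdivS lvl zc hdisj hcover A hC hcoer
  refine ⟨hunit, ?_⟩
  -- the owner's END
  set μ : UT N × Cp → ℝ := fun p => μ₀ * ((n p.1 : ℝ) ^ 2)⁻¹ with hμdef
  have hμpos : ∀ e, 0 < μ e := fun e => mul_pos hμ (inv_pos.mpr (pow_pos (hn0 e.1) 2))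
  set dd : UT N × Cp → UT N × Cp → ℝ := fun p q => sdist bsrc btgt n p.1 q.1 with hdd
  have hd0 : ∀ j, dd j j = 0 := fun j => sdist_self bsrc btgt n j.1
  have hcH : ∀ j, ∀ w : UT N × Cp → ℝ, ∑ e, μ e * w e ^ 2 ≤
      ∑ e, Real.exp (κ * dd e j) * w e * A (fun q => Real.exp (-(κ * dd q j)) * w q) e := by
    intro j w
    have h := hc_levelOp S hS hdivS lvl zc hdisj hcover Rm hRm T hT a ha ω hsupp hamax hscale c hc hcoer hκ0 hκ1 j w
    refine le_trans (le_of_eq (Finset.sum_congr rfl fun e _ => ?_)) h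
    rw [hμdef]
  have hEND := norm_cmat_inv_apply_le_local A dd hd0 hκ0 hμpos hcH p q
  -- read the matrix inverse as the inverse operator
  have hcm : ((LinearMap.toMatrix' A).map Complex.ofRealHom) = cmat A := rfl
  rw [hcm, ← cmat_ringInverse hunit, norm_cmat_apply] at hEND
  -- the local prefactors
  have hsqrt : Real.sqrt (μ p * μ q) = μ₀ / ((n p.1 : ℝ) * (n q.1 : ℝ)) := by
    have hp := hn0 p.1
    have hq := hn0 q.1
    have e : μ p * μ q = (μ₀ / ((n p.1 : ℝ) * (n q.1 : ℝ))) ^ 2 := by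
      rw [hμdef]
      field_simp
    rw [e, Real.sqrt_sq (div_nonneg hμ.le (mul_nonneg hp.le hq.le))]
  rw [hsqrt, div_div_eq_mul_div] at hEND
  exact hEND

end End

/-! ## §3 The two instances: `U = 1` ((D)) and COVARIANT under a per-cube (3.35)-shape gauge ((H)) -/

section Corollaries

/-- **k-UNIFORM DECAY AT `U = 1` (MODEL).**  The operator of (D) `multiscale_coercive_torus_flat` (`Δ + Σ_l a_lG_lᵀG_l`, plain block sums,
bond matrices and transports `= 1`) on a pairwise-disjoint COVERING cube family carrying the level weights, with print-size weights on both
sides (`a_min/S² ≤ a_lω_l²S_l^d ≤ a_max/S²`), `0 < c_min ≤ |c| ≤ c_max`, and a rate `0 ≤ κ ≤ 1` with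
`μ₀ = min(c_min²/(4d), a_min/2) − 2d·c_max²κ² − a_max(e^{2dκ} − 1) > 0`:
`|(levelOp)⁻¹(δ_{(y,i′)})(x,i)| ≤ e^{−κ·d_n(x,y)}·n(x)n(y)/μ₀` — nothing depends on the sides, the levels, their number or the volume.
[cite: Balaban1985BackgroundPropagators, (3.24) p.394 + Thm 3.1 (3.42) p.397; Balaban1984PropagatorsII, (2.46) p.231] -/
theorem decay_levelOp_flat (hdisj : ∀ k k' v v', cellPt S hS hdivS lvl zc k v = cellPt S hS hdivS lvl zc k' v' → k = k')
    (hcover : ∀ x : UT N, ∃ k, ∃ v : Box d (S (lvl k)), cellPt S hS hdivS lvl zc k v = x)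
    (a : J → ℝ) (ha : ∀ j, 0 ≤ a j) (ω : J → UT N → ℝ)
    (hsupp : ∀ l x, ω l (ctrU N (S l) (tblk (hS l) (hdivS l) x)) ≠ 0 → ∃ k v, lvl k = l ∧ cellPt S hS hdivS lvl zc k v = x)
    {amin amax : ℝ} (hamin : 0 ≤ amin) (hamax : 0 ≤ amax)
    (hscale_lo : ∀ k, amin / (S (lvl k) : ℝ) ^ 2 ≤ a (lvl k) * ω (lvl k) (ctrU N (S (lvl k)) (zc k)) ^ 2 * (S (lvl k) : ℝ) ^ d)
    (hscale_hi : ∀ k, a (lvl k) * ω (lvl k) (ctrU N (S (lvl k)) (zc k)) ^ 2 * (S (lvl k) : ℝ) ^ d ≤ amax / (S (lvl k) : ℝ) ^ 2)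
    (c : UT N × Fin d → ℝ) {cmin cmax : ℝ} (hcmin : 0 < cmin) (hc_lo : ∀ b, cmin ≤ |c b|) (hc_hi : ∀ b, |c b| ≤ cmax)
    {κ : ℝ} (hκ0 : 0 ≤ κ) (hκ1 : κ ≤ 1)
    (hμ : 0 < min (cmin ^ 2 / (4 * d)) (amin / 2) - 2 * d * cmax ^ 2 * κ ^ 2 - amax * (Real.exp (2 * d * κ) - 1))
    (p q : UT N × Cp) :
    IsUnit (levelOp bsrc btgt c (fun _ => (oneM : Cp → Cp → ℝ)) (fun l x => ctrU N (S l) (tblk (hS l) (hdivS l) x))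
        (fun l x => ω l (ctrU N (S l) (tblk (hS l) (hdivS l) x))) (fun _ _ => (oneM : Cp → Cp → ℝ)) a) ∧
      |Ring.inverse (levelOp bsrc btgt c (fun _ => (oneM : Cp → Cp → ℝ)) (fun l x => ctrU N (S l) (tblk (hS l) (hdivS l) x))
          (fun l x => ω l (ctrU N (S l) (tblk (hS l) (hdivS l) x))) (fun _ _ => (oneM : Cp → Cp → ℝ)) a) (Pi.single q 1) p| ≤
        Real.exp (-(κ * sdist bsrc btgt (siteScale S hS hdivS lvl zc hcover) p.1 q.1)) *
          ((siteScale S hS hdivS lvl zc hcover p.1 : ℝ) * (siteScale S hS hdivS lvl zc hcover q.1 : ℝ)) /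
          (min (cmin ^ 2 / (4 * d)) (amin / 2) - 2 * d * cmax ^ 2 * κ ^ 2 - amax * (Real.exp (2 * d * κ) - 1)) :=
  decay_levelOp S hS hdivS lvl zc hdisj hcover (fun _ => oneM) (fun _ i j => oneM_orth i j) (fun _ _ => oneM)
    (fun _ _ i i' => oneM_orth i i') a ha ω hsupp hamax hscale_hi c hc_hi
    (fun f => multiscale_coercive_torus_flat (Nat.one_le_iff_ne_zero.mpr (NeZero.ne d)) S hS hdivS a ha ω c hcmin hc_lo lvl zc
      hdisj hamin hscale_lo f)
    hκ0 hκ1 hμ p q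

/-- **k-UNIFORM COVARIANT DECAY UNDER A PER-CUBE (3.35)-SHAPE GAUGE (MODEL).**  The operator of (H) `multiscale_coercive_torus_cov` — ANY
orthogonal bond matrices `Rm`, block means through the contour transports of the cube combs — on a pairwise-disjoint COVERING cube family
carrying the level weights (print-size on both sides), `0 < c_min ≤ |c| ≤ c_max`, on each cell an orthogonal box gauge whose gauged in-cube
bond variables are `ε_k`-close to `1` with loss budget `4(dS(S−1))dε_k² + 4(d(S−1)ε_k)² ≤ θ`, and a rate `0 ≤ κ ≤ 1` with
`μ₀ = (1 − θ)·min(c_min²/(4d), a_min/4) − 2d·c_max²κ² − a_max(e^{2dκ} − 1) > 0`: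
`|(levelOp)⁻¹(δ_{(y,i′)})(x,i)| ≤ e^{−κ·d_n(x,y)}·n(x)n(y)/μ₀` — for `ε_k = C₁/S_{l_k}`, `θ = 8d²C₁²`: constants seeing `d, c, a, C₁` only.
[cite: Balaban1985BackgroundPropagators, (3.19) p.393 + (3.24) p.394 + (3.35) p.396 + Thm 3.1 (3.42) p.397; Balaban1984PropagatorsII, (2.46) p.231] -/
theorem decay_levelOp_cov (hdisj : ∀ k k' v v', cellPt S hS hdivS lvl zc k v = cellPt S hS hdivS lvl zc k' v' → k = k')
    (hcover : ∀ x : UT N, ∃ k, ∃ v : Box d (S (lvl k)), cellPt S hS hdivS lvl zc k v = x)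
    (Rm : UT N × Fin d → Cp → Cp → ℝ) (hRm : ∀ b i j, ∑ k, Rm b k i * Rm b k j = if i = j then (1 : ℝ) else 0)
    (a : J → ℝ) (ha : ∀ j, 0 ≤ a j) (ω : J → UT N → ℝ)
    (hsupp : ∀ l x, ω l (ctrU N (S l) (tblk (hS l) (hdivS l) x)) ≠ 0 → ∃ k v, lvl k = l ∧ cellPt S hS hdivS lvl zc k v = x)
    {amin amax : ℝ} (hamin : 0 ≤ amin) (hamax : 0 ≤ amax)
    (hscale_lo : ∀ k, amin / (S (lvl k) : ℝ) ^ 2 ≤ a (lvl k) * ω (lvl k) (ctrU N (S (lvl k)) (zc k)) ^ 2 * (S (lvl k) : ℝ) ^ d)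
    (hscale_hi : ∀ k, a (lvl k) * ω (lvl k) (ctrU N (S (lvl k)) (zc k)) ^ 2 * (S (lvl k) : ℝ) ^ d ≤ amax / (S (lvl k) : ℝ) ^ 2)
    (c : UT N × Fin d → ℝ) {cmin cmax : ℝ} (hcmin : 0 < cmin) (hc_lo : ∀ b, cmin ≤ |c b|) (hc_hi : ∀ b, |c b| ≤ cmax)
    (g : (k : K) → Box d (S (lvl k)) → Cp → Cp → ℝ)
    (hg : ∀ k v i i', ∑ k', g k v k' i * g k v k' i' = if i = i' then (1 : ℝ) else 0) (ε : K → ℝ) (hε : ∀ k, 0 ≤ ε k)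
    (hgauge : ∀ k (v : Box d (S (lvl k))) (i : Fin d) (hv : (v i : ℕ) + 1 < S (lvl k)) (u : Cp → ℝ),
      ∑ a', (∑ j, (hol Rm (g k) (fun v i _ => (cellPt S hS hdivS lvl zc k v, i)) v i hv a' j -
        if a' = j then 1 else 0) * u j) ^ 2 ≤ ε k ^ 2 * ∑ j, u j ^ 2)
    {θ : ℝ} (hloss : ∀ k, 4 * ((d : ℝ) * (S (lvl k)) * ((S (lvl k) : ℝ) - 1)) * d * ε k ^ 2 +
      4 * ((d * (S (lvl k) - 1) : ℕ) * ε k) ^ 2 ≤ θ)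
    {κ : ℝ} (hκ0 : 0 ≤ κ) (hκ1 : κ ≤ 1)
    (hμ : 0 < (1 - θ) * min (cmin ^ 2 / (4 * d)) (amin / 4) - 2 * d * cmax ^ 2 * κ ^ 2 - amax * (Real.exp (2 * d * κ) - 1))
    (p q : UT N × Cp) :
    IsUnit (levelOp bsrc btgt c Rm (fun l x => ctrU N (S l) (tblk (hS l) (hdivS l) x))
        (fun l x => ω l (ctrU N (S l) (tblk (hS l) (hdivS l) x))) (fun l x => (torusComb (hS l) (hdivS l)).tr Rm x) a) ∧
      |Ring.inverse (levelOp bsrc btgt c Rm (fun l x => ctrU N (S l) (tblk (hS l) (hdivS l) x))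
          (fun l x => ω l (ctrU N (S l) (tblk (hS l) (hdivS l) x))) (fun l x => (torusComb (hS l) (hdivS l)).tr Rm x) a)
          (Pi.single q 1) p| ≤
        Real.exp (-(κ * sdist bsrc btgt (siteScale S hS hdivS lvl zc hcover) p.1 q.1)) *
          ((siteScale S hS hdivS lvl zc hcover p.1 : ℝ) * (siteScale S hS hdivS lvl zc hcover q.1 : ℝ)) /
          ((1 - θ) * min (cmin ^ 2 / (4 * d)) (amin / 4) - 2 * d * cmax ^ 2 * κ ^ 2 - amax * (Real.exp (2 * d * κ) - 1)) :=
  decay_levelOp S hS hdivS lvl zc hdisj hcover Rm hRm (fun l x => (torusComb (hS l) (hdivS l)).tr Rm x)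
    (fun l x i i' => (torusComb (hS l) (hdivS l)).tr_orth Rm hRm x i i') a ha ω hsupp hamax hscale_hi c hc_hi
    (fun f => multiscale_coercive_torus_cov (Nat.one_le_iff_ne_zero.mpr (NeZero.ne d)) S hS hdivS Rm hRm a ha ω c hcmin hc_lo lvl zc
      hdisj hamin hscale_lo g hg ε hε hgauge hloss f)
    hκ0 hκ1 hμ p q

end Corollaries

end

end Summit.QuantumFields.BalabanUV.Beta.MultiscaleDecay
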